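import Literature.Topology.FourManifolds.WallHandlebodyBoundary
import Literature.Topology.FourManifolds.MorseEulerCharacteristic
import Literature.Topology.FourManifolds.SPC4HandlesCancelStep
import Literature.Topology.FourManifolds.DisjointSpheresSlab
import Literature.Topology.FourManifolds.ImmersionOrientation
import Literature.Topology.FourManifolds.SPC4HandleChainProofs
import Literature.Topology.FourManifolds.MorseTurnAbout
import Literature.AlgebraicTopology.SingularHomology.LefschetzDualityProofs
import Literature.AlgebraicTopology.SingularHomology.BoundaryTransfer
import Literature.AlgebraicTopology.SingularHomology.UniversalCoefficientsProofs
import Literature.AlgebraicTopology.SingularHomology.CompactManifoldFiniteness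
import Literature.AlgebraicTopology.SingularHomology.CohomologyFiniteness
import Literature.AlgebraicTopology.SingularHomology.FundamentalClassExistence
import HarnessLib

/-!
# Wall 1964, §2, p. 145: "`L` satisfies the same conditions as `K`" — proved
(discharge of `Literature.Topology.FourManifolds.isotropic_range_map_boundary_of_hasHandleDecomposition`)

Sibling proof file of `WallHandlebodyBoundary.lean`.  C. T. C. Wall, *On simply-connected
4-manifolds*, J. London Math. Soc. 39 (1964), §2, p. 145: "let `L` be the kernel of
`H₂(∂V) → H₂(V)`; then `L` satisfies the same conditions as `K`" — i.e. (pp. 144–145) `L` is a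
direct summand of `H₂(∂V)` of half rank and is isotropic — for a handlebody `V ∈ ℋ(5, k, 2)`.  The
tree states this cohomologically modulo torsion (`L = im (H²(V; ℤ)/T → H²(∂V; ℤ)/T)`, see the
docstring of the fact).  Wall prints no proof; the statement is the standard consequence of the
handle structure of `V` and of Poincaré–Lefschetz duality, and this file PROVES it from theorems of
`Literature`, along the following lines.

* **Morse homology of `V`** (Milnor, *Lectures on the h-cobordism theorem* (1965), §3, Cor. 3.15 and
  the Remark after Thm. 3.14; Thm. 4.8).  View `V` as the triad `(V; ∅, ∂V)`
  (`Cobordism.ofBoundary`), rescale the adapted Morse function of the handle decomposition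
  (`IsMorseAdapted.exists_isMorseFunction_ofBoundary`) and rearrange it into a nice one with the
  same numbers of critical points of each index (`Cobordism.Milnor1965_finalRearrangement_holds`):
  one of index `0`, `k` of index `2`, none other.  Along Milnor's filtration by sublevel sets, the
  steps have homology free of rank the number of critical points, concentrated in one degree
  (`Cobordism.Milnor1965_morseHomology_free_holds`), so the exact sequences of the triples give
  **`H₄(V; ℤ) = 0`** and **`H₂(V; ℤ)` torsion-free** (and finitely generated).
* **Every component of `V` meets `∂V`**: the maximum of the Morse function on a component is
  attained on the boundary, since an interior local maximum is a critical point of index `5`.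
* **A relative fundamental class** `w ∈ H₅(V, ∂V; ℤ)` with `∂w = [∂V]_β`: `∂` is onto because
  `H₄(V) = 0`, and a class whose boundary is a fundamental class of `∂V` is a relative fundamental
  class (`isRelFundamentalClass_of_isGenerator_toLocal_δ_of_isManifold`, Hatcher §3.3 p. 252 ff.).
* **Duality**: Lefschetz duality for `(V, ∂V)` (Spanier Thm. 6.3.12 = Hatcher Thm. 3.43, the tree's
  `bijective_relCapProduct_of_isRelFundamentalClass_holds`), Poincaré duality for `∂V`
  (Hatcher Thm. 3.30, `bijective_poincareDualityMap_of_one_le`), the left square of the duality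
  ladder `D(im ι^*) = im ∂ = ker ι_*` (`map_range_cohomologyMap_eq_range_δ`, Hatcher p. 254) and
  "half lives, half dies" (`two_mul_finrank_range_cohomologyMap_eq`, Thom 1952 Cor. V.8) with
  universal coefficients (`finrank_range_cohomologyMap_eq_finrank_range_homologyMap`).
* **Conclusion**: half rank by the above; isotropy because
  `Q(ι^*a, ι^*b) = ⟨a ⌣ b, ι_*[∂V]⟩` and `ι_*[∂V] ∈ H₄(V; ℤ) = 0`; direct summand because the
  quotient `(H²(∂V)/T)/L` is torsion-free (if `N·b ∈ im ι^*` then `N·ι_*(Db) = 0` in the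
  torsion-free `H₂(V)`, so `Db ∈ ker ι_* = D(im ι^*)` and `b ∈ im ι^*`), hence free, hence `L` is
  complemented.

Everything is proved; no definitions of mathematical content and no named facts are introduced.

## References

* C. T. C. Wall, *On simply-connected 4-manifolds*, J. London Math. Soc. 39 (1964) 141–149, §2,
  pp. 144–145. [WallJLMS1964]
* J. Milnor, *Lectures on the h-cobordism theorem*, Princeton (1965), Def. 3.1, Thm. 3.14,
  Cor. 3.15 and Remark, Thm. 4.8. [MilnorHCobordism1965]
* A. Hatcher, *Algebraic Topology*, CUP (2002), §3.1 Thm. 3.2, §3.3 Thm. 3.30, Thm. 3.43 and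
  p. 254. [HatcherAT2002]
* E. H. Spanier, *Algebraic Topology*, Springer (1981), Ch. 6 §3 Thm. 12. [Spanier1981]
* R. Thom, *Espaces fibrés en sphères et carrés de Steenrod*, Ann. Sci. ENS 69 (1952), Cor. V.8.
  [Thom1952]
-/

noncomputable section

open scoped Manifold ContDiff Topology
open Set Function Module CategoryTheory CategoryTheory.Limits
open Literature.AlgebraicTopology.SingularHomology

namespace Literature.Topology.FourManifolds

universe u

/-! ### Morse homology along Milnor's filtration: `H₄ = 0` and `H₂` torsion-free -/

/-- Torsion-freeness pulls back along an injective linear map. [folklore] -/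
theorem isTorsionFree_of_injective {A B : Type*} [AddCommGroup A] [Module ℤ A] [AddCommGroup B]
    [Module ℤ B] (hB : Module.IsTorsionFree ℤ B) (f : A →ₗ[ℤ] B) (hf : Function.Injective f) :
    Module.IsTorsionFree ℤ A :=
  haveI := hB
  hf.moduleIsTorsionFree f (fun r m => f.map_smul r m)

namespace Cobordism

variable {n : ℕ} {M N : Type u} [TopologicalSpace M] [T2Space M] [SecondCountableTopology M]
  [ChartedSpace (EuclideanSpace ℝ (Fin n)) M] [IsManifold (𝓡 n) ∞ M] [CompactSpace M]
  [TopologicalSpace N] [T2Space N] [SecondCountableTopology N]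
  [ChartedSpace (EuclideanSpace ℝ (Fin n)) N] [IsManifold (𝓡 n) ∞ N] [CompactSpace N]
  {c : Cobordism n M N} {g : c.W → ℝ}

/-- A step `W_{k-1} ⊆ W_k` of Milnor's filtration without critical points of index `k` has
vanishing relative homology in every degree (Milnor 1965, Cor. 3.15 and the Remark after
Thm. 3.14: free of rank the number of critical points of index `k`, concentrated in degree `k`;
the tree's `Cobordism.Milnor1965_morseHomology_free_holds`).
[cite: MilnorHCobordism1965, Cor. 3.15 and Remark after Thm. 3.14 (PDF pp. 19–21)] -/
theorem IsNiceMorseFunction.isZero_morseHomology_of_ncard_eq_zero (hg : c.IsNiceMorseFunction g)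
    {k : ℕ} (hk : (criticalSetOfIndex (𝓡∂ (n + 1)) g k).ncard = 0) (i : ℕ) :
    IsZero (c.morseHomology g k i) := by
  obtain ⟨hZ, hFree, hFin, hrk⟩ := Milnor1965_morseHomology_free_holds hg k
  by_cases hik : i = k
  · subst hik
    rw [hk] at hrk
    haveI := hFree
    haveI := hFin
    haveI : Subsingleton (c.morseHomology g i i) := Module.finrank_zero_iff.1 hrk
    exact ModuleCat.isZero_of_subsingleton _
  · exact hZ i hik

/-- Off the degree `k`, the step `W_{k-1} ⊆ W_k` of Milnor's filtration has vanishing relative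
homology (Milnor 1965, Cor. 3.15; the tree's `Cobordism.Milnor1965_morseHomology_free_holds`).
[cite: MilnorHCobordism1965, Cor. 3.15 (PDF p. 19)] -/
theorem IsNiceMorseFunction.isZero_morseHomology_of_ne (hg : c.IsNiceMorseFunction g) {k i : ℕ}
    (hik : i ≠ k) : IsZero (c.morseHomology g k i) :=
  (Milnor1965_morseHomology_free_holds hg k).1 i hik

/-- **`H₄(W_m, V) = 0` and `H₂(W_m, V)` is torsion-free** along Milnor's filtration
`V = W_{-1} ⊆ W_0 ⊆ ⋯ ⊆ W_{n+1} = W` (`W_{m-1} = {g ≤ cutLevel n m}`) of a nice Morse function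
without critical points of index `3` and `4`: by induction on `m`, from the exact sequences of the
triples `(W_m, W_{m-1}, V)` (Hatcher 2002, p. 118) and Milnor's computation of the steps
(Cor. 3.15: `H⁎(W_m, W_{m-1})` free, concentrated in degree `m`, of rank the number of critical
points of index `m`).  In degree `2` the step `m = 2` embeds `H₂(W_2, V)` into the free group
`H₂(W_2, W_1)` (`H₂(W_1, V) = 0`), and every other step is an isomorphism.
[cite: MilnorHCobordism1965, Cor. 3.15 and Remark after Thm. 3.14 (PDF pp. 19–21), Thm. 7.4 (PDF p. 48)]
[cite: HatcherAT2002, §2.1 p. 118 (exact sequence of a triple)] -/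
theorem IsNiceMorseFunction.isZero_four_and_isTorsionFree_two (hg : c.IsNiceMorseFunction g)
    (h3 : (criticalSetOfIndex (𝓡∂ (n + 1)) g 3).ncard = 0)
    (h4 : (criticalSetOfIndex (𝓡∂ (n + 1)) g 4).ncard = 0) :
    ∀ m ≤ n + 2, IsZero (sublevelHomology g (cutLevel n 0) (cutLevel n m) 4) ∧
      Module.IsTorsionFree ℤ (sublevelHomology g (cutLevel n 0) (cutLevel n m) 2) := by
  intro m
  induction m with
  | zero =>
    intro _
    have hZ : ∀ i, IsZero (sublevelHomology g (cutLevel n 0) (cutLevel n 0) i) :=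
      fun i => isZero_sublevelHomology_self g _ i
    haveI : Subsingleton (sublevelHomology g (cutLevel n 0) (cutLevel n 0) 2) :=
      ModuleCat.subsingleton_of_isZero (hZ 2)
    exact ⟨hZ 4, inferInstance⟩
  | succ m ih =>
    intro hm
    obtain ⟨ih4, ih2⟩ := ih ((Nat.le_succ m).trans hm)
    have hab : cutLevel n 0 ≤ cutLevel n m := cutLevel_mono n (Nat.zero_le m)
    have hbt : cutLevel n m ≤ cutLevel n (m + 1) := cutLevel_mono n (Nat.le_succ m)
    -- the relative homology of the step `W_{m-1} ⊆ W_m` vanishes in degrees `4` and `3`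
    have hs4 : IsZero (c.morseHomology g m 4) := by
      by_cases hm4 : m = 4
      · subst hm4; exact hg.isZero_morseHomology_of_ncard_eq_zero h4 4
      · exact hg.isZero_morseHomology_of_ne (Ne.symm hm4)
    have hs3 : IsZero (c.morseHomology g m 3) := by
      by_cases hm3 : m = 3
      · subst hm3; exact hg.isZero_morseHomology_of_ncard_eq_zero h3 3
      · exact hg.isZero_morseHomology_of_ne (Ne.symm hm3)
    refine ⟨?_, ?_⟩
    · -- degree `4`: `H₄(W_{m-1}, V) → H₄(W_m, V) → H₄(W_m, W_{m-1})` with both ends zero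
      exact (sublevel_exact₂ g hab hbt 4).isZero_of_both_zeros (ih4.eq_of_src _ _)
        (hs4.eq_of_tgt _ _)
    · by_cases hm2 : m = 2
      · -- the step `m = 2`: `0 = H₂(W_1, V) → H₂(W_2, V) → H₂(W_2, W_1)`, the latter free
        subst hm2
        have hA : IsZero (sublevelHomology g (cutLevel n 0) (cutLevel n 2) 2) :=
          (hg.morseCount_filtration 2 (by omega)).2.1 2 le_rfl
        have hex := sublevel_exact₂ g hab hbt 2
        have hmono : Mono (sublevelRelax g hab (cutLevel n (2 + 1)) 2) :=
          hex.mono_g (hA.eq_of_src _ _)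
        obtain ⟨-, hFree, -, -⟩ := Milnor1965_morseHomology_free_holds hg 2
        have hT : Module.IsTorsionFree ℤ (sublevelHomology g (cutLevel n 2) (cutLevel n (2 + 1)) 2) := by
          haveI := hFree
          infer_instance
        have hinj : Function.Injective (sublevelRelax g hab (cutLevel n (2 + 1)) 2).hom :=
          (ModuleCat.mono_iff_injective _).1 hmono
        exact isTorsionFree_of_injective hT _ hinj
      · -- `m ≠ 2`: `H₂(W_{m-1}, V) → H₂(W_m, V)` is an isomorphism
        have hs2 : IsZero (c.morseHomology g m 2) := hg.isZero_morseHomology_of_ne (Ne.symm hm2)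
        have hmono : Mono (sublevelMap g (cutLevel n 0) hbt 2) :=
          (sublevel_exact₁ g hab hbt 2).mono_g (hs3.eq_of_src _ _)
        have hepi : Epi (sublevelMap g (cutLevel n 0) hbt 2) :=
          (sublevel_exact₂ g hab hbt 2).epi_f (hs2.eq_of_tgt _ _)
        haveI : IsIso (sublevelMap g (cutLevel n 0) hbt 2) := isIso_of_mono_of_epi _
        let e := (asIso (sublevelMap g (cutLevel n 0) hbt 2)).toLinearEquiv
        exact isTorsionFree_of_injective ih2 e.symm.toLinearMap e.symm.injective

end Cobordism

/-! ### The handlebody `V ∈ ℋ(5, k, 2)`: `H₄(V; ℤ) = 0`, `H₂(V; ℤ)` torsion-free -/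

section Handlebody

variable (V : Type) [TopologicalSpace V] [T2Space V] [SecondCountableTopology V]
  [ChartedSpace (EuclideanHalfSpace (4 + 1)) V] [IsManifold (𝓡∂ (4 + 1)) ∞ V] [CompactSpace V]

/-- **A nice Morse function presenting `V ∈ ℋ(5, k, 2)`**: on the triad `(V; ∅, ∂V)` there is a
nice (self-indexing) Morse function with one critical point of index `0`, `k` of index `2` and
none of other indices — the adapted Morse function of the handle decomposition rescaled into
Milnor's normalisation (Def. 3.1) and rearranged by Thm. 4.8 (same critical points and indices).
[cite: MilnorHCobordism1965, Def. 3.1 (PDF p. 11), Thm. 4.8 (PDF p. 25)] -/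
theorem exists_isNiceMorseFunction_of_hasHandleDecomposition {k : ℕ}
    (hV : HasHandleDecomposition 4 V (twoHandlebodyCount k)) :
    ∃ g : V → ℝ, (Cobordism.ofBoundary 4 V).IsNiceMorseFunction g ∧
      ∀ j, (criticalSetOfIndex (𝓡∂ (4 + 1)) g j).ncard = twoHandlebodyCount k j := by
  haveI : CompactSpace ((𝓡∂ (4 + 1)).boundary V) := compactSpace_boundary 4 V
  obtain ⟨f, hf, hcount⟩ := hV
  obtain ⟨s, -, hF, hSf⟩ := hf.exists_isMorseFunction_ofBoundary
  obtain ⟨g, hg, hcrit, hind⟩ := Cobordism.Milnor1965_finalRearrangement_holds hF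
  refine ⟨g, hg, fun j => ?_⟩
  have e1 : criticalSetOfIndex (𝓡∂ (4 + 1)) g j = criticalSetOfIndex (𝓡∂ (4 + 1)) f j :=
    (criticalSetOfIndex_congr hcrit hind j).trans (hSf j)
  exact (congrArg Set.ncard e1).trans (hcount j)

/-- **Homology of a handlebody `V ∈ ℋ(5, k, 2)`** (Milnor 1965, §3 and Thm. 7.4; Smale): for a
compact smooth `5`-manifold with boundary admitting a handle decomposition with one `0`-handle and
`k` `2`-handles, `H₄(V; ℤ) = 0` and `H₂(V; ℤ)` is a finitely generated torsion-free abelian group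
(indeed `V ≃ ⋁ᵏ S²`; only what is used below is recorded).  From the filtration of a nice Morse
function on `(V; ∅, ∂V)` (`Cobordism.IsNiceMorseFunction.isZero_four_and_isTorsionFree_two`) and
`H⁎(V, ∅) = H⁎(V)`.
[cite: MilnorHCobordism1965, Cor. 3.15 and Remark (PDF pp. 19–21), Thm. 7.4 (PDF p. 48)] -/
theorem isZero_four_isTorsionFree_two_of_hasHandleDecomposition {k : ℕ}
    (hV : HasHandleDecomposition 4 V (twoHandlebodyCount k)) :
    IsZero (singularHomology ℤ ℤ V 4) ∧ Module.IsTorsionFree ℤ (singularHomology ℤ ℤ V 2) ∧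
      Module.Finite ℤ (singularHomology ℤ ℤ V 2) := by
  haveI : CompactSpace ((𝓡∂ (4 + 1)).boundary V) := compactSpace_boundary 4 V
  obtain ⟨g, hg, hcount⟩ := exists_isNiceMorseFunction_of_hasHandleDecomposition V hV
  have h3 : (criticalSetOfIndex (𝓡∂ (4 + 1)) g 3).ncard = 0 :=
    (hcount 3).trans (twoHandlebodyCount_of_ne (by norm_num) (by norm_num))
  have h4 : (criticalSetOfIndex (𝓡∂ (4 + 1)) g 4).ncard = 0 :=
    (hcount 4).trans (twoHandlebodyCount_of_ne (by norm_num) (by norm_num))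
  obtain ⟨hZ4', hT2'⟩ := hg.isZero_four_and_isTorsionFree_two h3 h4 (4 + 2) le_rfl
  obtain ⟨hF', -, -⟩ := hg.morseCount_filtration (4 + 2) le_rfl
  -- the same statements, read on `V = (V; ∅, ∂V).W`
  have hZ4 : IsZero (sublevelHomology g (Cobordism.cutLevel 4 0) (Cobordism.cutLevel 4 (4 + 2)) 4) :=
    hZ4'
  have hT2 : Module.IsTorsionFree ℤ
      (sublevelHomology g (Cobordism.cutLevel 4 0) (Cobordism.cutLevel 4 (4 + 2)) 2) := hT2'
  have hF2 : Module.Finite ℤ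
      (sublevelHomology g (Cobordism.cutLevel 4 0) (Cobordism.cutLevel 4 (4 + 2)) 2) := hF' 2
  -- `W_5 = V` and `W_{-1} = ∅`
  have htop : ∀ z : V, g z ≤ Cobordism.cutLevel 4 (4 + 2) := fun z => by
    rw [Cobordism.cutLevel_eq_one]; exact (hg.isMorseFunction.mem_Icc z).2
  have hset : {z : V | g z ≤ Cobordism.cutLevel 4 0} = range (Cobordism.ofBoundary 4 V).inl :=
    hg.isMorseFunction.setOf_le_cutLevel_zero
  haveI hE : IsEmpty ↥({z : V | g z ≤ Cobordism.cutLevel 4 0}) :=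
    ⟨fun z => by
      have hz : (z : V) ∈ range (Cobordism.ofBoundary 4 V).inl := hset ▸ z.2
      obtain ⟨x, -⟩ := hz
      exact PEmpty.elim x⟩
  have e : ∀ i, singularHomology ℤ ℤ V i ≅
      sublevelHomology g (Cobordism.cutLevel 4 0) (Cobordism.cutLevel 4 (4 + 2)) i := fun i =>
    haveI := relativeSingularHomology.isIso_ofAbsolute_of_isEmpty ℤ ℤ
      ({z : V | g z ≤ Cobordism.cutLevel 4 0}) i
    asIso (relativeSingularHomology.ofAbsolute ℤ ℤ V {z : V | g z ≤ Cobordism.cutLevel 4 0} i)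
      ≪≫ (sublevelHomologyTopIso g (Cobordism.cutLevel 4 0) htop i).symm
  refine ⟨hZ4.of_iso (e 4), ?_, ?_⟩
  · exact isTorsionFree_of_injective hT2 (e 2).toLinearEquiv.toLinearMap
      (e 2).toLinearEquiv.injective
  · haveI := hF2
    exact Module.Finite.equiv (e 2).toLinearEquiv.symm

omit [T2Space V] [SecondCountableTopology V] in
/-- **Every component of a handlebody `V ∈ ℋ(5, k, 2)` meets `∂V`.**  For a Morse function
`f` adapted to `∂V` without critical points of index `5`, the maximum of `f` on a connected
component (a compact open set) is attained at a boundary point: an interior maximum would be a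
critical point (Fermat) of index `5 = dim V` (the Hessian of `1 - f` at a local minimum is
positive semidefinite; Milnor, *Morse theory* (1963), §2). [cite: Milnor1963, §2 (index of a nondegenerate maximum)] -/
theorem exists_mem_boundary_mem_connectedComponent_of_isMorseAdapted {f : V → ℝ}
    (hf : IsMorseAdapted (𝓡∂ (4 + 1)) f) (h5 : criticalSetOfIndex (𝓡∂ (4 + 1)) f (4 + 1) = ∅)
    (x : V) : ∃ y ∈ (𝓡∂ (4 + 1)).boundary V, y ∈ connectedComponent x := by
  haveI : LocallyConnectedSpace V :=
    ChartedSpace.locallyConnectedSpace (EuclideanHalfSpace (4 + 1)) V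
  have hC : IsCompact (connectedComponent x) := isClosed_connectedComponent.isCompact
  obtain ⟨y, hy, hmax⟩ := hC.exists_isMaxOn ⟨x, mem_connectedComponent⟩
    hf.isMorse.contMDiff.continuous.continuousOn
  refine ⟨y, ?_, hy⟩
  by_contra hyB
  have hint : (𝓡∂ (4 + 1)).IsInteriorPoint y := by
    have hy' : y ∈ ((𝓡∂ (4 + 1)).boundary V)ᶜ := hyB
    rwa [ModelWithCorners.compl_boundary] at hy'
  have hlmax : IsLocalMax f y := hmax.isLocalMax (isOpen_connectedComponent.mem_nhds hy)
  have hcrit : IsMCriticalPt (𝓡∂ (4 + 1)) f y := isMCriticalPt_of_isLocalMax hlmax hint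
  have hmin : IsLocalMin (fun z => 1 - f z) y := isLocalMin_const.sub hlmax
  have hF : IsMorse (𝓡∂ (4 + 1)) (fun z => 1 - f z) := hf.isMorse.const_sub 1
  have h0 : morseIndex (𝓡∂ (4 + 1)) (fun z => 1 - f z) y = 0 :=
    morseIndex_eq_zero_of_isLocalMin_of_isInteriorPoint
      (hF.contMDiff.contMDiffAt.of_le (by norm_cast)) hmin hint
  have hadd := hf.isMorse.morseIndex_const_sub_add 1 hcrit
  rw [h0, zero_add, finrank_euclideanSpace_fin] at hadd
  have hmem : y ∈ criticalSetOfIndex (𝓡∂ (4 + 1)) f (4 + 1) := ⟨hcrit, hadd⟩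
  rw [h5] at hmem
  exact hmem

end Handlebody

/-! ### Algebra: torsion-free quotients and complements -/

section Algebra

variable {R : Type*} [CommRing R] [IsDomain R] {F : Type*} [AddCommGroup F] [Module R F]

/-- If `a • x ∈ L` with `a ≠ 0` forces `x ∈ L`, then `F ⧸ L` is torsion-free. [folklore] -/
private theorem isTorsionFree_quotient_of_smul_mem (L : Submodule R F)
    (h : ∀ (a : R) (x : F), a ≠ 0 → a • x ∈ L → x ∈ L) : Module.IsTorsionFree R (F ⧸ L) := by
  rw [Submodule.isTorsionFree_iff_torsion_eq_bot, eq_bot_iff]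
  intro x hx
  obtain ⟨a, ha⟩ := (Submodule.mem_torsion_iff x).1 hx
  obtain ⟨y, rfl⟩ := L.mkQ_surjective x
  rw [Submodule.mem_bot, Submodule.mkQ_apply, Submodule.Quotient.mk_eq_zero]
  refine h a y (nonZeroDivisors.coe_ne_zero a) ?_
  rw [← Submodule.Quotient.mk_eq_zero L, Submodule.Quotient.mk_smul]
  exact ha

/-- A submodule of a finitely generated module over a principal ideal domain with torsion-free
quotient is complemented: the quotient is free (finitely generated and torsion-free), hence
projective, so the quotient map splits. [folklore] -/
private theorem exists_isCompl_of_isTorsionFree_quotient [IsPrincipalIdealRing R]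
    [Module.Finite R F] (L : Submodule R F) [Module.IsTorsionFree R (F ⧸ L)] :
    ∃ L' : Submodule R F, IsCompl L L' := by
  haveI : Module.Free R (F ⧸ L) := Module.free_of_finite_type_torsion_free'
  obtain ⟨s, hs⟩ := Module.projective_lifting_property L.mkQ LinearMap.id L.mkQ_surjective
  have hsec : ∀ q, L.mkQ (s q) = q := fun q => LinearMap.congr_fun hs q
  have hπ : ∀ x, ((LinearMap.id : F →ₗ[R] F) - s.comp L.mkQ) x ∈ L := fun x => by
    apply (Submodule.Quotient.mk_eq_zero L).1
    rw [← Submodule.mkQ_apply L, LinearMap.sub_apply, map_sub, LinearMap.comp_apply, hsec,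
      LinearMap.id_apply, sub_self]
  refine ⟨LinearMap.ker (LinearMap.codRestrict L ((LinearMap.id : F →ₗ[R] F) - s.comp L.mkQ) hπ),
    LinearMap.isCompl_of_proj fun x => ?_⟩
  apply Subtype.ext
  rw [LinearMap.codRestrict_apply, LinearMap.sub_apply, LinearMap.comp_apply, Submodule.mkQ_apply,
    (Submodule.Quotient.mk_eq_zero L).2 x.2, map_zero, LinearMap.id_apply, sub_zero]

/-- **The saturation argument behind "`L` is a direct summand"**, abstractly: `mk : H → F` is onto
with torsion kernel (`F = H/T`), `S ⊆ H` (the image of `ι^*`), `D : H → H₂B` is one-to-one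
(Poincaré duality) with `D(S) = ker j` (the duality ladder and exactness), and the target of
`j : H₂B → H₂V` (the map `ι_*`) is torsion-free.  Then `mk(S)` is saturated in `F`: if
`a • x ∈ mk(S)` with `a ≠ 0` then `x ∈ mk(S)`. [folklore] -/
private theorem mem_map_of_smul_mem_map {H H₂B H₂V : Type*} [AddCommGroup H] [Module R H]
    [AddCommGroup H₂B] [Module R H₂B] [AddCommGroup H₂V] [Module R H₂V] [Module.IsTorsionFree R H₂V]
    (mk : H →ₗ[R] F) (hmk : Function.Surjective mk) (hker : LinearMap.ker mk ≤ Submodule.torsion R H)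
    (S : Submodule R H) (D : H →ₗ[R] H₂B) (hD : Function.Injective D) (j : H₂B →ₗ[R] H₂V)
    (hDS : S.map D = LinearMap.ker j) {a : R} (ha : a ≠ 0) {x : F} (hx : a • x ∈ S.map mk) :
    x ∈ S.map mk := by
  obtain ⟨b, rfl⟩ := hmk x
  obtain ⟨s, hs, hsb⟩ := hx
  have h1 : a • b - s ∈ LinearMap.ker mk := by
    rw [LinearMap.mem_ker, map_sub, map_smul, hsb, sub_self]
  obtain ⟨c, hc⟩ := (Submodule.mem_torsion_iff _).1 (hker h1)
  have h2 : ((c : R) * a) • b ∈ S := by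
    have hc' : (c : R) • (a • b - s) = 0 := hc
    rw [smul_sub, sub_eq_zero, smul_smul] at hc'
    rw [hc']
    exact S.smul_mem _ hs
  have hN : (c : R) * a ≠ 0 := mul_ne_zero (nonZeroDivisors.coe_ne_zero c) ha
  have h3 : D (((c : R) * a) • b) ∈ LinearMap.ker j := hDS ▸ Submodule.mem_map_of_mem h2
  rw [LinearMap.mem_ker, map_smul, map_smul] at h3
  have h4 : j (D b) = 0 := (smul_eq_zero_iff_right hN).1 h3
  have h5 : D b ∈ S.map D := by rw [hDS]; exact h4
  obtain ⟨s', hs', he⟩ := h5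
  exact ⟨b, hD he ▸ hs', rfl⟩

omit [IsDomain R] in
/-- Ranks of abelian groups do not depend on the chosen `ℤ`-module structure (there is only one,
`AddCommMonoid.subsingletonIntModule`); used to pass between the instance found on submodules
(`AddCommGroup.toIntModule`) and `Submodule.module`. [folklore] -/
private theorem finrank_int_irrel {T : Type*} [AddCommGroup T] (i₁ i₂ : Module ℤ T) :
    @Module.finrank ℤ T _ _ i₁ = @Module.finrank ℤ T _ _ i₂ := by
  rw [Subsingleton.elim i₁ i₂]

omit [IsDomain R] in
/-- In a zero object of `ModuleCat` every element vanishes. [folklore] -/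
private theorem eq_zero_of_isZero_moduleCat {P : ModuleCat.{u} R} (h : IsZero P) (x : P) : x = 0 := by
  haveI := ModuleCat.subsingleton_of_isZero h
  exact Subsingleton.elim _ _

end Algebra

/-! ### Wall's conditions on `L = im (H²(V; ℤ)/T → H²(∂V; ℤ)/T)` -/

section Main

/-- **Wall 1964, §2, p. 145: "`L` satisfies the same conditions as `K`" — discharge of the named
fact `isotropic_range_map_boundary_of_hasHandleDecomposition`.**  For a compact smooth
`5`-manifold `V` with a handle decomposition with one `0`-handle and `k` `2`-handles and any
`ℤ`-orientation `β` of `∂V`, the image `L` of `H²(V; ℤ)/T → H²(∂V; ℤ)/T` is a direct summand, is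
isotropic for the intersection form `Q_β`, and `2 · rank L = rank H²(∂V; ℤ)/T`.  PROVED (see the
module docstring): Morse homology of `V` (`H₄(V) = 0`, `H₂(V)` torsion-free), a relative
fundamental class `w` with `∂w = [∂V]_β`, Lefschetz duality for `(V, ∂V)`, Poincaré duality for
`∂V`, the duality ladder, "half lives, half dies" and universal coefficients; then the rank
identity, isotropy (`⟨a ⌣ b, ι_*[∂V]⟩ = 0`) and the saturation of `L` (so that the quotient is
free and `L` is complemented).
[cite: WallJLMS1964, §2 p. 145 ("L satisfies the same conditions as K")]
[cite: HatcherAT2002, §3.3 Thm. 3.43 and p. 254; Thm. 3.30]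
[cite: MilnorHCobordism1965, Cor. 3.15, Thm. 4.8, Thm. 7.4] -/
theorem isotropic_range_map_boundary_of_hasHandleDecomposition_holds :
    isotropic_range_map_boundary_of_hasHandleDecomposition := by
  intro V _ _ _ _ _ _ k hV β
  haveI : CompactSpace ((𝓡∂ (4 + 1)).boundary V) := compactSpace_boundary 4 V
  -- Morse theory of the handlebody
  obtain ⟨h4, htf, hfin⟩ := isZero_four_isTorsionFree_two_of_hasHandleDecomposition V hV
  obtain ⟨f, hf, hcount⟩ := hV
  have h5 : criticalSetOfIndex (𝓡∂ (4 + 1)) f (4 + 1) = ∅ := by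
    have hfin5 : (criticalSetOfIndex (𝓡∂ (4 + 1)) f (4 + 1)).Finite :=
      (IsMorse.finite_criticalSet_holds hf.isMorse).subset (criticalSetOfIndex_subset _ _ _)
    exact (Set.ncard_eq_zero hfin5).1
      ((hcount (4 + 1)).trans (twoHandlebodyCount_of_ne (by norm_num) (by norm_num)))
  have hcomp : ∀ x : V, ∃ y ∈ (𝓡∂ (4 + 1)).boundary V, y ∈ connectedComponent x :=
    exists_mem_boundary_mem_connectedComponent_of_isMorseAdapted V hf h5
  -- the fundamental class of `∂V`, and a relative fundamental class `w` with `∂w = [∂V]`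
  have hfc : IsFundamentalClass β β.fundamentalClass :=
    HomologicalOrientation.isFundamentalClass_fundamentalClass_holds (R := ℤ)
      (X := ↥((𝓡∂ (4 + 1)).boundary V)) 4 β
  have hepi : Epi (relativeSingularHomology.δ ℤ ℤ V ((𝓡∂ (4 + 1)).boundary V) 4) :=
    (relativeSingularHomology.exact_δ_map ℤ ℤ ((𝓡∂ (4 + 1)).boundary V) 4).epi_f (h4.eq_of_tgt _ _)
  obtain ⟨w, hw⟩ := (ModuleCat.epi_iff_surjective _).1 hepi β.fundamentalClass
  have hw' : (relativeSingularHomology.δ ℤ ℤ V ((𝓡∂ (4 + 1)).boundary V) 4) w = β.fundamentalClass :=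
    hw
  have hinf : (∞ : WithTop ℕ∞) ≠ 0 := by simp
  have hwf : IsRelFundamentalClass ℤ ((𝓡∂ (4 + 1)).boundary V) w := by
    refine isRelFundamentalClass_of_isGenerator_toLocal_δ_of_isManifold (R := ℤ) hinf four_ne_zero w
      (fun y => ?_) hcomp
    obtain ⟨e, he⟩ := β.isGenerator y
    refine ⟨e, ?_⟩
    rw [hw', hfc y, he]
  -- Lefschetz duality for `w`, Poincaré duality for `β`
  have hL := bijective_relCapProduct_of_isRelFundamentalClass_holds (R := ℤ) 4 V w hwf
    (show 2 + (2 + 1) = 4 + 1 from rfl)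
  unfold bijective_relCapProduct_of_isRelFundamentalClass at hL
  have hD0 := bijective_poincareDualityMap_of_one_le (R := ℤ) (by norm_num : 1 ≤ 4) β
    two_add_two_eq_four
  have hD : Function.Bijective (poincareDualityMap β two_add_two_eq_four) := hD0
  -- the duality ladder `D(im ι^*) = im ∂`, and exactness `im ∂ = ker ι_*`
  have hlad := map_range_cohomologyMap_eq_range_δ (R := ℤ) (M := ℤ) w two_add_two_eq_four hL.2
  rw [hw'] at hlad
  have hker : LinearMap.range (relativeSingularHomology.δ ℤ ℤ V ((𝓡∂ (4 + 1)).boundary V) 2).hom =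
      LinearMap.ker (singularHomology.map ℤ ℤ
        (⟨Subtype.val, continuous_subtype_val⟩ : C(↥((𝓡∂ (4 + 1)).boundary V), V)) 2).hom :=
    (relativeSingularHomology.exact_δ_map ℤ ℤ ((𝓡∂ (4 + 1)).boundary V) 2).moduleCat_range_eq_ker
  -- finiteness of the (co)homology involved
  haveI : Module.Finite ℤ (singularHomology ℤ ℤ ↥((𝓡∂ (4 + 1)).boundary V) 2) :=
    finite_singularHomology_of_compactSpace_holds ℤ _ 4 2
  haveI : Module.Finite ℤ (singularHomology ℤ ℤ ↥((𝓡∂ (4 + 1)).boundary V) 1) :=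
    finite_singularHomology_of_compactSpace_holds ℤ _ 4 1
  have hF2c : Module.Finite ℤ (singularCohomology ℤ ℤ ↥((𝓡∂ (4 + 1)).boundary V) 2) :=
    finite_singularCohomology_of_compact_chartedSpace ℤ ℤ (d := 4) 2
  haveI := hF2c
  haveI : Module.Finite ℤ (singularHomology ℤ ℤ V 2) := hfin
  haveI : Module.Finite ℤ (freeCohomology ℤ ↥((𝓡∂ (4 + 1)).boundary V) 2) :=
    finite_freeCohomology (R := ℤ) (n := 4) hF2c
  haveI := htf
  -- universal coefficients and "half lives, half dies"
  have hK := finrank_range_cohomologyMap_eq_finrank_range_homologyMap (R := ℤ)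
    (⟨Subtype.val, continuous_subtype_val⟩ : C(↥((𝓡∂ (4 + 1)).boundary V), V)) (p := 2)
    (kroneckerMap_surjective_holds ℤ V 2) (ker_kroneckerMap_le_torsion_holds ℤ _ 1)
  have hrank := two_mul_finrank_range_cohomologyMap_eq (R := ℤ) two_add_two_eq_four w hL.2
    (by rw [hw']; exact hD.1) hK
  -- `L = mk (im ι^*)`
  have hLS : LinearMap.range (freeCohomology.map (R := ℤ)
        (⟨Subtype.val, continuous_subtype_val⟩ : C(↥((𝓡∂ (4 + 1)).boundary V), V)) 2) =
      Submodule.map freeCohomology.mk (LinearMap.range (singularCohomology.map ℤ ℤ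
        (⟨Subtype.val, continuous_subtype_val⟩ : C(↥((𝓡∂ (4 + 1)).boundary V), V)) 2).hom) := by
    apply le_antisymm
    · rintro _ ⟨x, rfl⟩
      induction x using freeCohomology.induction_on with
      | h a => exact ⟨_, ⟨a, rfl⟩, (freeCohomology.map_mk _ a).symm⟩
    · rintro _ ⟨s, ⟨a, rfl⟩, rfl⟩
      exact ⟨freeCohomology.mk a, freeCohomology.map_mk _ a⟩
  refine ⟨?_, ?_, ?_⟩
  · -- `L` is a direct summand: the quotient is torsion-free, hence free, hence `L` is complemented
    have hDS : Submodule.map (poincareDualityMap β two_add_two_eq_four)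
        (LinearMap.range (singularCohomology.map ℤ ℤ
          (⟨Subtype.val, continuous_subtype_val⟩ : C(↥((𝓡∂ (4 + 1)).boundary V), V)) 2).hom) =
        LinearMap.ker (singularHomology.map ℤ ℤ
          (⟨Subtype.val, continuous_subtype_val⟩ : C(↥((𝓡∂ (4 + 1)).boundary V), V)) 2).hom :=
      hlad.trans hker
    haveI := isTorsionFree_quotient_of_smul_mem (R := ℤ)
      (LinearMap.range (freeCohomology.map (R := ℤ)
        (⟨Subtype.val, continuous_subtype_val⟩ : C(↥((𝓡∂ (4 + 1)).boundary V), V)) 2))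
      (fun a x ha hx => by
        rw [hLS] at hx ⊢
        exact mem_map_of_smul_mem_map freeCohomology.mk freeCohomology.mk_surjective
          (by rw [freeCohomology.ker_mk]) _ (poincareDualityMap β two_add_two_eq_four) hD.1
          (singularHomology.map ℤ ℤ
            (⟨Subtype.val, continuous_subtype_val⟩ : C(↥((𝓡∂ (4 + 1)).boundary V), V)) 2).hom
          hDS ha hx)
    exact exists_isCompl_of_isTorsionFree_quotient _
  · -- isotropy: `Q(ι^*a, ι^*b) = ⟨a ⌣ b, ι_*[∂V]⟩` and `H₄(V) = 0`
    rintro x ⟨x₀, rfl⟩ y ⟨y₀, rfl⟩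
    induction x₀ using freeCohomology.induction_on with
    | h a =>
      induction y₀ using freeCohomology.induction_on with
      | h b =>
        rw [freeCohomology.map_mk, freeCohomology.map_mk, intersectionForm_mk_mk, cupPairing_apply,
          ← cupProduct_map, kroneckerPairing_map,
          eq_zero_of_isZero_moduleCat h4 ((singularHomology.map ℤ ℤ
            (⟨Subtype.val, continuous_subtype_val⟩ : C(↥((𝓡∂ (4 + 1)).boundary V), V)) 4)
            β.fundamentalClass), map_zero]
  · -- half rank
    rw [hLS]
    have hfr := finrank_map_eq_of_ker_le_torsion
      (freeCohomology.mk (R := ℤ) (X := ↥((𝓡∂ (4 + 1)).boundary V)) (k := 2))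
      (by rw [freeCohomology.ker_mk])
      (LinearMap.range (singularCohomology.map ℤ ℤ
        (⟨Subtype.val, continuous_subtype_val⟩ : C(↥((𝓡∂ (4 + 1)).boundary V), V)) 2).hom)
    have hft : Module.finrank ℤ (freeCohomology ℤ ↥((𝓡∂ (4 + 1)).boundary V) 2) =
        Module.finrank ℤ (singularCohomology ℤ ℤ ↥((𝓡∂ (4 + 1)).boundary V) 2) :=
      finrank_quotient_torsion
    have hpd := (poincareDualityEquiv β two_add_two_eq_four hD0).finrank_eq
    have hirr := finrank_int_irrel
      (T := ↥(Submodule.map (freeCohomology.mk (R := ℤ) (X := ↥((𝓡∂ (4 + 1)).boundary V)) (k := 2))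
        (LinearMap.range (singularCohomology.map ℤ ℤ
          (⟨Subtype.val, continuous_subtype_val⟩ : C(↥((𝓡∂ (4 + 1)).boundary V), V)) 2).hom)))
      (AddCommGroup.toIntModule _) (Submodule.module _)
    exact (congrArg (2 * ·) (hirr.trans hfr)).trans (hrank.trans (hpd.symm.trans hft.symm))

end Main

end Literature.Topology.FourManifolds

end
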